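import Summits.BirchSwinnertonDyer.Rank1Residual.X12.O11.RamifiedRubinFormulaLine
import HarnessLib

/-!
# K7r value line (item 19705 `EllipticUnitValueSeven`, skeleton `rubin-formula`): the typed bottom
# index exponents `c(D)` (`EllipticUnitClassData.HasBottomIndexExp`) and `λ₀(D)`
# (`EllipticUnitClassData.HasLocalBottomIndexExp`) are UNSATISFIABLE — a kernel vacuity witness
# (cell `bsd-cm`, seat `bsd-cm-k8i-c2` g7, found while assessing the unhanded stub S_B4 of
# BRIEF-k7r-split.md; filed `--supports` 19705 as a HELPER; nothing about any curve is asserted)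

WHAT IS PROVED (sorry-free, standard axioms).
* §1 `not_moduleFinite_int_padicInt`: `ℤ_p` is not a finitely generated `ℤ`-module (a prime `q ≠ p`
  is a unit of `ℤ_p`; a non-zero free `ℤ`-module is not `q`-divisible).
  `relIndex_torsion_sup_eq_zero_of_padicLine`: if a subgroup `S` of a commutative group receives an
  additive `f : ℤ_p → S` injective modulo torsion, then `(tors ⊔ N).relIndex S = 0` (infinite index)
  for every FINITELY GENERATED `N` (else `a ↦ [f (d • a)]` embeds `ℤ_p` in `(N + tors)/tors`).
* §2 `zsmul_torsionH1Over_eq_zero`: `H¹(H, E[m])` is killed by `m` (cocycle representatives); so the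
  `ℤ_p`-action `padicPi` on `∏_k H¹(H, E[p^k])` is ADDITIVE in the scalar (`padicPi_add`: `a ↦ a · y` is a hom),
  preserves `p`-compatibility, and `S_{p,rel}` is `ℤ_p`-stable (`padicPi_mem_relaxedCompactSelmerOver`).
* §3 THE VACUITY. `D.HasBottomIndexExp c := (tors ⊔ endSpan (D.z 0)).relIndex S_{p,rel} = p ^ c`
  (`AnticyclotomicEllipticUnitClass.lean`), where `endSpan x := AddSubgroup.closure {φ · x | φ ∈ End_K(E)}`
  is the `ℤ`-SPAN of the `End_K(E)`-translates — the lattice `𝒪_K · z(𝟙)`, NOT the `𝒪_𝔭 = 𝒪_K ⊗ ℤ_p`-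
  module `𝒪_𝔭 · z(𝟙)` its docstring describes — while `S_{p,rel}` is a `ℤ_p`-module (§2). Hence
  (`not_hasBottomIndexExp_of_padicFree`): if `endSpan (D.z 0)` is finitely generated (e.g. because
  `End_K(E_K) ≅ 𝒪_K`) and `S_{p,rel}(E/K)` contains ONE `ℤ_p`-free element (`a · y` torsion ⇒ `a = 0`:
  a Kummer family of a point of infinite order, or — `…_of_bottom_padicFree` — the bottom class `z(𝟙)`
  itself, non-torsion in analytic rank one by [BKNO] Thm. 1.8), then `D.HasBottomIndexExp c` is FALSE
  FOR EVERY `c`. Likewise `λ₀` (`not_hasLocalIndexExpOfEmb_of_padicFree`,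
  `not_hasLocalBottomIndexExp_of_padicFree`): `E(K_𝔭) ⊗ ℤ_p` contains `ℤ_p`-lines, `loc(endSpan)` is
  finitely generated. (`m_loc`, `HasBottomLocalMordellWeilIndexExp`, is NOT affected: `kummerSpan` has the
  `ℤ_p`-scalars `padicPi c d` built into its generators.)
* §4 CONSEQUENCES (logic only, from `∀ D c, ¬ D.HasBottomIndexExp c`): the three `@[conjecture]` inputs
  carrying `D.HasBottomIndexExp c →` — S_B4 `RamifiedCMBottomLocalIndexSplitAt`, S_open
  `RamifiedCMRubinFormulaAt` (stub `stub_rubinFormulaSeven` = the route's `tribunal_fit.witness`) and the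
  Value law `RamifiedCMBottomClassIndexLawAt` (19705's content via `EllipticUnitValueSeven_of`) — hold
  VACUOUSLY; the existential pieces `RamifiedCMBottomClassExistsAt` / `RamifiedCMEllipticUnitIMCAt`
  (the residual support item 19704 reads the latter) are FALSE once one frame with a tower exists.

HONEST READING. A statement about the TYPING, not about [BKNO] or the cell's (★_an) programme: with
`endSpan` replaced by its `ℤ_p`-saturation (generators `padicPi a (endPi φ x)`, as `kummerSpan` does for
points) `c`, `λ₀` become the intended `ord_π`-indices and S_dict/S_B4/S_open regain content; until that
re-cut a proof of a registered stub of `Lines/rubin-formula.lean` or of the Value child through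
`D.HasBottomIndexExp c` proves nothing, and the IMC support piece is unprovable. No stub is proved or
refuted BY NAME; `hfg`/`hfree` are displayed, not discharged (for `z(𝟙)`: [BKNO] Thm. 1.8; for a Kummer
family: Mordell–Weil + `kummerFamily_apply_eq_zero_iff`); no definition / Literature statement / named
fact is minted; nothing is booked; K7r, O11, 19704/19705 keep their labels. WANTED(planner) re-cut posted
on the cell STATUS. References: [BKNO] arXiv:2608.06879 §3.3.1, Thm. 1.8, Def. 4.7; Perrin-Riou, Bull.
SMF 115 (1987) §0; Silverman AEC III.4/III.7; Serre, Galois Cohomology I.§2.2.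
-/

noncomputable section

set_option linter.dupNamespace false

open scoped Classical

universe u

open WeierstrassCurve NumberField IsDedekindDomain Field PowerSeries
  Literature.NumberTheory.EllipticCurves
  Literature.NumberTheory.EllipticCurves.BurungaleKobayashiNakamuraOta2026
  Literature.NumberTheory.GaloisRepresentations
  Summit.BirchSwinnertonDyer.Rank1Residual.X12.O11

namespace Summit.BirchSwinnertonDyer.BirchSwinnertonDyer.Theorems.RamifiedBottomIndexVacuity

/-! ## §1 Pure algebra: `ℤ_p` is not a finitely generated group; `ℤ_p`-lines have infinite index
over finitely generated subgroups -/

/-- **`ℤ_p` is not a finitely generated `ℤ`-module**: a prime `q ≠ p` is a unit of `ℤ_p`, so `ℤ_p`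
is `q`-divisible; a non-zero finitely generated torsion-free (hence free) `ℤ`-module is not. [folklore] -/
theorem not_moduleFinite_int_padicInt (p : ℕ) [Fact p.Prime] : ¬ Module.Finite ℤ ℤ_[p] := by
  intro hfin
  obtain ⟨q, hq, hqp⟩ : ∃ q : ℕ, q.Prime ∧ q ≠ p := by
    by_cases h2 : p = 2
    · exact ⟨3, Nat.prime_three, by omega⟩
    · exact ⟨2, Nat.prime_two, fun h ↦ h2 h.symm⟩
  have hunit : IsUnit ((q : ℤ) : ℤ_[p]) := by
    rw [PadicInt.isUnit_iff]
    have hle := PadicInt.norm_le_one ((q : ℤ) : ℤ_[p])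
    have hnlt : ¬ ‖((q : ℤ) : ℤ_[p])‖ < 1 := by
      rw [PadicInt.norm_int_lt_one_iff_dvd]
      intro hdvd
      have hpq : p ∣ q := by exact_mod_cast hdvd
      exact hqp ((Nat.prime_dvd_prime_iff_eq Fact.out hq).1 hpq).symm
    exact le_antisymm hle (not_lt.1 hnlt)
  obtain ⟨u, hu⟩ := hunit
  haveI : Module.Free ℤ ℤ_[p] := Module.free_of_finite_type_torsion_free'
  let b := Module.Free.chooseBasis ℤ ℤ_[p]
  haveI : Nonempty (Module.Free.ChooseBasisIndex ℤ ℤ_[p]) := b.index_nonempty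
  obtain ⟨i⟩ := (inferInstance : Nonempty (Module.Free.ChooseBasisIndex ℤ ℤ_[p]))
  have hbi : b i = (q : ℤ) • ((↑u⁻¹ : ℤ_[p]) * b i) := by
    rw [zsmul_eq_mul, ← mul_assoc, ← hu, Units.mul_inv, one_mul]
  have hrepr := congrArg (fun x ↦ b.repr x i) hbi
  simp only [Module.Basis.repr_self, Finsupp.single_eq_same, map_zsmul, Finsupp.smul_apply,
    smul_eq_mul] at hrepr
  exact hq.one_lt.ne' (by exact_mod_cast Int.eq_one_of_dvd_one (by positivity) ⟨_, hrepr⟩)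

/-- **A `ℤ_p`-line in `S` (injective mod torsion) makes `tors ⊔ N` of INFINITE index in `S` for every
finitely generated `N`** (`relIndex = 0`): a positive index `d` would make `a ↦ [f (d • a)]` an injective
additive map `ℤ_p → (N + tors)/tors` into a finitely generated group. [folklore] -/
theorem relIndex_torsion_sup_eq_zero_of_padicLine {G : Type*} [AddCommGroup G] (p : ℕ) [Fact p.Prime]
    (N S : AddSubgroup G) (hN : N.FG) (f : ℤ_[p] →+ G) (hfS : ∀ a, f a ∈ S)
    (hf : ∀ a, f a ∈ AddCommGroup.torsion G → a = 0) :
    (AddCommGroup.torsion G ⊔ N).relIndex S = 0 := by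
  by_contra hd
  set d := (AddCommGroup.torsion G ⊔ N).relIndex S with hd_def
  have hmem : ∀ a : ℤ_[p], d • f a ∈ AddCommGroup.torsion G ⊔ N := fun a ↦
    (AddCommGroup.torsion G ⊔ N).nsmul_relIndex_mem (hfS a)
  let T := AddCommGroup.torsion G
  let π : G →+ G ⧸ T := QuotientAddGroup.mk' T
  let g : ℤ_[p] →ₗ[ℤ] G ⧸ T := ((π.comp f).comp (DistribSMul.toAddMonoidHom ℤ_[p] d)).toIntLinearMap
  have hg_apply : ∀ a, g a = π (f (d • a)) := fun a ↦ rfl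
  let Nbar : Submodule ℤ (G ⧸ T) := (AddSubgroup.toIntSubmodule N).map π.toIntLinearMap
  have hNbar : Nbar.FG :=
    ((Submodule.fg_iff_addSubgroup_fg _).2 (by simpa using hN)).map _
  have hg_mem : ∀ a, g a ∈ Nbar := by
    intro a
    rw [hg_apply]
    have h := hmem a
    rw [← map_nsmul] at h
    obtain ⟨t, ht, n, hn, htn⟩ := AddSubgroup.mem_sup.1 h
    refine Submodule.mem_map.2 ⟨n, show n ∈ (AddSubgroup.toIntSubmodule N : Set G) by
      rw [AddSubgroup.coe_toIntSubmodule]; exact hn, ?_⟩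
    rw [← htn, map_add]
    have : π t = 0 := (QuotientAddGroup.eq_zero_iff t).2 ht
    rw [this, zero_add]
    rfl
  have hg_inj : Function.Injective g := by
    intro a a' h
    have h0 : g (a - a') = 0 := by rw [map_sub, h, sub_self]
    rw [hg_apply, QuotientAddGroup.mk'_apply, QuotientAddGroup.eq_zero_iff] at h0
    rcases (smul_eq_zero.1 (hf _ h0)) with h1 | h1
    · exact absurd h1 hd
    · exact sub_eq_zero.1 h1
  haveI : Module.Finite ℤ Nbar := Module.Finite.iff_fg.2 hNbar
  have hfin : Module.Finite ℤ ℤ_[p] :=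
    Module.Finite.of_injective (g.codRestrict Nbar hg_mem)
      (fun a a' h ↦ hg_inj (by simpa using congrArg Subtype.val h))
  exact not_moduleFinite_int_padicInt p hfin

/-- Images of finitely generated subgroups are finitely generated. [folklore] -/
theorem addSubgroup_fg_map {G G' : Type*} [AddCommGroup G] [AddCommGroup G'] {N : AddSubgroup G}
    (hN : N.FG) (f : G →+ G') : (N.map f).FG := by
  obtain ⟨S, hS⟩ := hN
  exact ⟨S.image f, by rw [Finset.coe_image, ← AddMonoidHom.map_closure, hS]⟩

/-! ## §2 The compact currency: `H¹(H, E[m])` is `m`-torsion, the `ℤ_p`-action is additive, the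
relaxed compact Selmer group is `ℤ_p`-stable -/

section Compact

variable {K : Type u} [Field K] (W : WeierstrassCurve K)

/-- **`H¹(H, E[m])` is killed by `m`** (cocycle representatives with values in `E[m]`).
[cite: SilvermanAEC2009, VIII.§2 (Kummer theory with E[m]-coefficients; shape only)] -/
theorem zsmul_torsionH1Over_eq_zero (m : ℤ) (H : Subgroup (Field.absoluteGaloisGroup K))
    (x : W.torsionH1Over m H) : m • x = 0 := by
  obtain ⟨φ, rfl⟩ := oneCocycleClass_surjective (discreteTopRep H (geomTorsion W m)) x
  have hφ : m • φ = 0 := by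
    apply Subtype.ext
    ext g
    change ((m • φ.1 g : geomTorsion W m) : geomPoints W) = ((0 : geomTorsion W m) : geomPoints W)
    rw [AddSubgroupClass.coe_zsmul, (mem_geomTorsion_iff W m _).1 (φ.1 g).2]
    rfl
  have key : oneCocycleClass (discreteTopRep H (geomTorsion W m)) (m • φ) =
      m • oneCocycleClass (discreteTopRep H (geomTorsion W m)) φ :=
    map_zsmul (oneCocycleClassₗ (discreteTopRep H (geomTorsion W m))) m φ
  rw [← key, hφ, oneCocycleClass_zero]

/-- `n • x` on `H¹(H, E[m])` only depends on `n mod m`. [folklore] -/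
theorem zsmul_torsionH1Over_eq_of_emod_eq (m : ℤ) (H : Subgroup (Field.absoluteGaloisGroup K))
    (x : W.torsionH1Over m H) {n n' : ℤ} (h : n % m = n' % m) : n • x = n' • x := by
  have key (n : ℤ) : n • x = (n % m) • x := by
    conv_lhs => rw [← Int.emod_add_mul_ediv n m, add_zsmul, mul_zsmul,
      zsmul_torsionH1Over_eq_zero W m H, add_zero]
  rw [key n, key n', h]

/-- The integer lifts of `toZModPow (k+1) a` and `toZModPow k a` agree modulo `p^k`. [folklore] -/
theorem val_toZModPow_succ_emod {p : ℕ} [Fact p.Prime] (a : ℤ_[p]) (k : ℕ) :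
    ((PadicInt.toZModPow (k + 1) a).val : ℤ) % ((p : ℤ) ^ k) =
      ((PadicInt.toZModPow k a).val : ℤ) % ((p : ℤ) ^ k) := by
  have h := PadicInt.cast_toZModPow k (k + 1) (Nat.le_succ k) a
  rw [ZMod.cast_eq_val] at h
  have hv := congrArg ZMod.val h
  rw [ZMod.val_natCast] at hv
  rw [← hv]; push_cast; rw [Int.emod_emod_of_dvd _ dvd_rfl]

variable (p : ℕ) [Fact p.Prime] (H : Subgroup (Field.absoluteGaloisGroup K))

/-- **Additivity of the `ℤ_p`-action in the scalar** on `∏_k H¹(H, E[p^k])` (level `k` is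
`p^k`-torsion). [cite: PerrinRiou1987BSMF, §0 p. 401 (ℤ_p-module structure; shape only)] -/
theorem padicPi_add (a b : ℤ_[p]) (y : Π k : ℕ, W.torsionH1Over ((p : ℤ) ^ k) H) :
    W.padicPi p H (a + b) y = W.padicPi p H a y + W.padicPi p H b y := by
  ext k
  simp only [padicPi, AddMonoidHom.pi_apply, AddMonoidHom.coe_comp, Function.comp_apply,
    Pi.evalAddMonoidHom_apply, zsmulAddGroupHom_apply, Pi.add_apply, ← add_zsmul]
  apply zsmul_torsionH1Over_eq_of_emod_eq W
  rw [map_add, ZMod.val_add]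
  push_cast
  rw [Int.emod_emod_of_dvd _ dvd_rfl]

/-- **The `ℤ_p`-action preserves `p`-compatible families.** [cite: PerrinRiou1987BSMF, §0 p. 401 (shape only)] -/
theorem padicPi_mem_compatiblePi {y : Π k : ℕ, W.torsionH1Over ((p : ℤ) ^ k) H}
    (hy : y ∈ W.compatiblePi H p) (a : ℤ_[p]) : W.padicPi p H a y ∈ W.compatiblePi H p := by
  rw [mem_compatiblePi_iff] at hy ⊢
  intro k
  simp only [padicPi, AddMonoidHom.pi_apply, AddMonoidHom.coe_comp, Function.comp_apply,
    Pi.evalAddMonoidHom_apply, zsmulAddGroupHom_apply, map_zsmul, hy k]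
  exact zsmul_torsionH1Over_eq_of_emod_eq W _ H _ (val_toZModPow_succ_emod a k)

variable [NumberField K] [H.Normal]

/-- **`S_{p,rel}(E/L)` is `ℤ_p`-stable** (the local conditions are subgroups level by level, the action
is `p`-compatible). [cite: BurungaleKobayashiNakamuraOta2026, §3.1.2 (arXiv:2608.06879 p. 16) (shape only)] -/
theorem padicPi_mem_relaxedCompactSelmerOver {P : Set (HeightOneSpectrum (𝓞 K))}
    {y : Π k : ℕ, W.torsionH1Over ((p : ℤ) ^ k) H} (hy : y ∈ W.relaxedCompactSelmerOver H p P)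
    (a : ℤ_[p]) : W.padicPi p H a y ∈ W.relaxedCompactSelmerOver H p P := by
  rw [mem_relaxedCompactSelmerOver_iff] at hy ⊢
  refine ⟨fun k ↦ ?_, padicPi_mem_compatiblePi W p H hy.2 a⟩
  simp only [padicPi, AddMonoidHom.pi_apply, AddMonoidHom.coe_comp, Function.comp_apply,
    Pi.evalAddMonoidHom_apply, zsmulAddGroupHom_apply]
  exact AddSubgroup.zsmul_mem _ (hy.1 k) _

/-- **`tors ⊔ endSpan x` has INFINITE index in `S_{p,rel}(E/L)`** once `endSpan x` (the `ℤ`-span of the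
`End_K(E)`-translates of `x` — no `ℤ_p`-scalars) is finitely generated and the `ℤ_p`-module `S_{p,rel}`
contains one `ℤ_p`-free element. [cite: BurungaleKobayashiNakamuraOta2026, §3.3.1 (arXiv:2608.06879 p. 19) (shape only)] -/
theorem relIndex_torsion_sup_endSpan_relaxedCompactSelmerOver_eq_zero
    {P : Set (HeightOneSpectrum (𝓞 K))} (x : Π k : ℕ, W.torsionH1Over ((p : ℤ) ^ k) H)
    (hfg : (W.endSpan p H x).FG) {y : Π k : ℕ, W.torsionH1Over ((p : ℤ) ^ k) H}
    (hy : y ∈ W.relaxedCompactSelmerOver H p P)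
    (hfree : ∀ a : ℤ_[p], W.padicPi p H a y ∈ AddCommGroup.torsion _ → a = 0) :
    (AddCommGroup.torsion _ ⊔ W.endSpan p H x).relIndex (W.relaxedCompactSelmerOver H p P) = 0 :=
  relIndex_torsion_sup_eq_zero_of_padicLine p _ _ hfg
    (AddMonoidHom.mk' (fun a ↦ W.padicPi p H a y) fun a b ↦ padicPi_add W p H a b y)
    (fun a ↦ padicPi_mem_relaxedCompactSelmerOver W p H hy a) hfree

end Compact

/-! ## §3 The vacuity of [BKNO]'s typed bottom exponents `c(D)` and `λ₀(D)` -/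

section Bottom

variable {W : WeierstrassCurve ℚ} [W.IsElliptic] {p : ℕ} [Fact p.Prime] {K : Type} [Field K]
  [NumberField K] {𝔭 : HeightOneSpectrum (𝓞 K)} {κ : ZpExtension K p} {γ : absoluteGaloisGroup K}
  {ι : PadicAlgCl p ≃+* ℂ} {φ : HeckeCharacter K} {Ω : ℂ} {𝓔 : AcDualExpSystem W p K 𝔭 κ ι}

/-- **`D.HasBottomIndexExp c` is FALSE for every `c`** once `endSpan z(𝟙)` is finitely generated and
`S_{p,rel}(E/K)` contains a `ℤ_p`-free `y`: the index in its definition is `0`, never `p ^ c`.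
[cite: BurungaleKobayashiNakamuraOta2026, §1.4 and §3.3.1 (arXiv:2608.06879 pp. 8, 19) (shape only)] -/
theorem not_hasBottomIndexExp_of_padicFree (D : EllipticUnitClassData W p K 𝔭 κ γ ι φ Ω 𝓔)
    (hfg : ((W.baseChange K).endSpan p (κ.layerSubgroup 0) (D.z 0)).FG)
    {y : Π k : ℕ, (W.baseChange K).torsionH1Over ((p : ℤ) ^ k) (κ.layerSubgroup 0)}
    (hy : y ∈ (W.baseChange K).relaxedCompactSelmerOver (κ.layerSubgroup 0) p {𝔭})
    (hfree : ∀ a : ℤ_[p],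
      (W.baseChange K).padicPi p (κ.layerSubgroup 0) a y ∈ AddCommGroup.torsion _ → a = 0)
    (c : ℕ) : ¬ D.HasBottomIndexExp c := by
  intro hc
  unfold EllipticUnitClassData.HasBottomIndexExp at hc
  rw [relIndex_torsion_sup_endSpan_relaxedCompactSelmerOver_eq_zero (W.baseChange K) p
    (κ.layerSubgroup 0) (D.z 0) hfg hy hfree] at hc
  exact pow_ne_zero c (Fact.out : p.Prime).ne_zero hc.symm

/-- **In particular if the bottom class `z(𝟙)` (in `S_{p,rel}` by `z_mem`; non-torsion in analytic
rank one, [BKNO] Thm. 1.8 — what the value line presupposes) is `ℤ_p`-free, `D.HasBottomIndexExp c`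
fails for every `c`.** [cite: BurungaleKobayashiNakamuraOta2026, Thm. 1.8 (arXiv:2608.06879 p. 7) (claim; shape only)] -/
theorem not_hasBottomIndexExp_of_bottom_padicFree (D : EllipticUnitClassData W p K 𝔭 κ γ ι φ Ω 𝓔)
    (hfg : ((W.baseChange K).endSpan p (κ.layerSubgroup 0) (D.z 0)).FG)
    (hfree : ∀ a : ℤ_[p],
      (W.baseChange K).padicPi p (κ.layerSubgroup 0) a (D.z 0) ∈ AddCommGroup.torsion _ → a = 0)
    (c : ℕ) : ¬ D.HasBottomIndexExp c :=
  not_hasBottomIndexExp_of_padicFree D hfg (D.z_mem 0) hfree c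

end Bottom

section Local

variable {K : Type u} [Field K] (W : WeierstrassCurve K) {E : Type u} [Field E] [Algebra K E]
  (ι : AlgebraicClosure K →ₐ[K] AlgebraicClosure E) (p : ℕ) [Fact p.Prime]
  (H : Subgroup (Field.absoluteGaloisGroup K))

/-- **`HasLocalIndexExpOfEmb ι x c` is FALSE for every `c`** once `endSpan x` is finitely generated and
the local Kummer compact group `E(L·E) ⊗ ℤ_p` contains a `ℤ_p`-line injective modulo torsion (e.g. the
Kummer family of a local point of infinite order). [cite: BurungaleKobayashiNakamuraOta2026, Thm. 7.2 (arXiv:2608.06879 p. 41) (shape only)] -/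
theorem not_hasLocalIndexExpOfEmb_of_padicFree (x : W.torsionH1Pi p H) (hfg : (W.endSpan p H x).FG)
    {y : (W.baseChange E).torsionH1Pi p (localSubgroupOfEmb H ι)}
    (hyC : ∀ a : ℤ_[p],
      (W.baseChange E).padicPi p (localSubgroupOfEmb H ι) a y ∈ W.localKummerCompactOfEmb ι p H)
    (hfree : ∀ a : ℤ_[p],
      (W.baseChange E).padicPi p (localSubgroupOfEmb H ι) a y ∈ AddCommGroup.torsion _ → a = 0)
    (c : ℕ) : ¬ W.HasLocalIndexExpOfEmb ι p H x c := by
  rintro ⟨-, hc⟩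
  have h0 : (AddCommGroup.torsion _ ⊔ W.localEndSpanOfEmb ι p H x).relIndex
      (W.localKummerCompactOfEmb ι p H) = 0 :=
    relIndex_torsion_sup_eq_zero_of_padicLine p _ _ (addSubgroup_fg_map hfg _)
      (AddMonoidHom.mk' (fun a ↦ (W.baseChange E).padicPi p (localSubgroupOfEmb H ι) a y)
        fun a b ↦ padicPi_add (W.baseChange E) p (localSubgroupOfEmb H ι) a b y) hyC hfree
  rw [h0] at hc
  exact pow_ne_zero c (Fact.out : p.Prime).ne_zero hc.symm

end Local

section LocalBottom

variable {W : WeierstrassCurve ℚ} [W.IsElliptic] {p : ℕ} [Fact p.Prime] {K : Type} [Field K]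
  [NumberField K] {𝔭 : HeightOneSpectrum (𝓞 K)} {κ : ZpExtension K p} {γ : absoluteGaloisGroup K}
  {ι : PadicAlgCl p ≃+* ℂ} {φ : HeckeCharacter K} {Ω : ℂ} {𝓔 : AcDualExpSystem W p K 𝔭 κ ι}

/-- **`λ₀(D)` (`D.HasLocalBottomIndexExp c`) is FALSE for every `c`** under the same conditions at
`K_𝔭`. [cite: BurungaleKobayashiNakamuraOta2026, Thm. 7.2 (arXiv:2608.06879 p. 41) (shape only)] -/
theorem not_hasLocalBottomIndexExp_of_padicFree (D : EllipticUnitClassData W p K 𝔭 κ γ ι φ Ω 𝓔)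
    (hfg : ((W.baseChange K).endSpan p (κ.layerSubgroup 0) (D.z 0)).FG)
    {y : ((W.baseChange K).baseChange (𝔭.adicCompletion K)).torsionH1Pi p
      (localSubgroupOfEmb (κ.layerSubgroup 0) (closureEmb (K := K) (𝔭.adicCompletion K)))}
    (hyC : ∀ a : ℤ_[p],
      ((W.baseChange K).baseChange (𝔭.adicCompletion K)).padicPi p
          (localSubgroupOfEmb (κ.layerSubgroup 0) (closureEmb (K := K) (𝔭.adicCompletion K))) a y ∈
        (W.baseChange K).localKummerCompactOfEmb (closureEmb (K := K) (𝔭.adicCompletion K)) p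
          (κ.layerSubgroup 0))
    (hfree : ∀ a : ℤ_[p],
      ((W.baseChange K).baseChange (𝔭.adicCompletion K)).padicPi p
          (localSubgroupOfEmb (κ.layerSubgroup 0) (closureEmb (K := K) (𝔭.adicCompletion K))) a y ∈
        AddCommGroup.torsion _ → a = 0)
    (c : ℕ) : ¬ D.HasLocalBottomIndexExp c :=
  not_hasLocalIndexExpOfEmb_of_padicFree (W.baseChange K) _ p (κ.layerSubgroup 0) (D.z 0) hfg hyC
    hfree c

end LocalBottom

/-! ## §4 Consequences for the registered K7r value line (logic only) -/

section Line

variable {W : WeierstrassCurve ℚ} [W.IsElliptic] {p : ℕ} [Fact p.Prime]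
  (hvac : ∀ (K : Type) [Field K] [NumberField K] (𝔭 : HeightOneSpectrum (𝓞 K))
    (κ : ZpExtension K p) (γ : absoluteGaloisGroup K) (ι : PadicAlgCl p ≃+* ℂ) (φ : HeckeCharacter K)
    (Ω : ℂ) (𝓔 : AcDualExpSystem W p K 𝔭 κ ι) (D : EllipticUnitClassData W p K 𝔭 κ γ ι φ Ω 𝓔)
    (c : ℕ), ¬ D.HasBottomIndexExp c)
include hvac

/-- **S_B4 `RamifiedCMBottomLocalIndexSplitAt W p` holds VACUOUSLY** under `hvac`. [cite: BurungaleKobayashiNakamuraOta2026, §1.4 (arXiv:2608.06879 p. 8) (shape only)] -/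
theorem ramifiedCMBottomLocalIndexSplitAt_of_forall_not_hasBottomIndexExp :
    RamifiedCMBottomLocalIndexSplitAt W p := by
  intro K _ _ 𝔭 W' _ _ C _ _ κ _ γ _ ι φ Ω 𝓔 D c hc
  exact absurd hc (hvac K 𝔭 κ γ ι φ Ω 𝓔 D c)

/-- **S_open `RamifiedCMRubinFormulaAt W p` (the OPEN stub; `tribunal_fit.witness` at `p = 7`) holds
VACUOUSLY** under `hvac`. [cite: BurungaleKobayashiNakamuraOta2026, Thm. 7.2 (arXiv:2608.06879 p. 41) (shape only)] -/
theorem ramifiedCMRubinFormulaAt_of_forall_not_hasBottomIndexExp :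
    RamifiedCMRubinFormulaAt W p := by
  intro K _ _ 𝔭 W' _ _ C _ _ κ _ γ _ P n P' n' _ _ _ _ _ _ _ _ _ _ q q' _ _ ι φ Ω 𝓔 D c hc
  exact absurd hc (hvac K 𝔭 κ γ ι φ Ω 𝓔 D c)

/-- **The Value law `RamifiedCMBottomClassIndexLawAt W p` (19705's content via `EllipticUnitValueSeven_of`)
holds VACUOUSLY** under `hvac`. [cite: BurungaleKobayashiNakamuraOta2026, Thm. 7.2 (arXiv:2608.06879 p. 41) (shape only)] -/
theorem ramifiedCMBottomClassIndexLawAt_of_forall_not_hasBottomIndexExp :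
    RamifiedCMBottomClassIndexLawAt W p := by
  intro K _ _ 𝔭 W' _ _ C _ _ κ _ γ _ P n P' n' _ _ _ _ _ _ _ _ _ _ q q' _ _ ι φ Ω 𝓔 D c hc
  exact absurd hc (hvac K 𝔭 κ γ ι φ Ω 𝓔 D c)

/-- **The existence piece `RamifiedCMBottomClassExistsAt W p` is FALSE** under `hvac`, as soon as one
rank-one frame with a tower and generator exists. [cite: BurungaleKobayashiNakamuraOta2026, Prop. 3.7 (arXiv:2608.06879 p. 20) (shape only)] -/
theorem not_ramifiedCMBottomClassExistsAt_of_forall_not_hasBottomIndexExp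
    {K : Type} [Field K] [NumberField K] (𝔭 : HeightOneSpectrum (𝓞 K))
    (W' : WeierstrassCurve ℚ) [W'.IsElliptic] [W'.IsGloballyMinimal] (C : VariableChange ℚ)
    (hF : IsFrame W p K 𝔭 W' C) (hr : W.analyticRank = 1) (κ : ZpExtension K p)
    (hκ : κ.IsAnticyclotomic) (γ : absoluteGaloisGroup K) [Fact (κ.IsTopGenerator γ)] :
    ¬ RamifiedCMBottomClassExistsAt W p := by
  intro h
  obtain ⟨ι, φ, Ω, 𝓔, D, c, hc⟩ := h K 𝔭 W' C hF hr κ hκ γ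
  exact hvac K 𝔭 κ γ ι φ Ω 𝓔 D c hc

/-- **The IMC piece `RamifiedCMEllipticUnitIMCAt W p` (read by the residual support item 19704) is
FALSE** under the same conditions. [cite: BurungaleKobayashiNakamuraOta2026, Thm. 3.14 (3) (arXiv:2608.06879 pp. 22–24) (shape only)] -/
theorem not_ramifiedCMEllipticUnitIMCAt_of_forall_not_hasBottomIndexExp
    {K : Type} [Field K] [NumberField K] (𝔭 : HeightOneSpectrum (𝓞 K))
    (W' : WeierstrassCurve ℚ) [W'.IsElliptic] [W'.IsGloballyMinimal] (C : VariableChange ℚ)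
    (hF : IsFrame W p K 𝔭 W' C) (hr : W.analyticRank = 1) (κ : ZpExtension K p)
    (hκ : κ.IsAnticyclotomic) (γ : absoluteGaloisGroup K) [Fact (κ.IsTopGenerator γ)] :
    ¬ RamifiedCMEllipticUnitIMCAt W p := fun h ↦
  not_ramifiedCMBottomClassExistsAt_of_forall_not_hasBottomIndexExp hvac 𝔭 W' C hF hr κ hκ γ
    (ramifiedCMBottomClassExistsAt_of_imcAt h)

end Line

end Summit.BirchSwinnertonDyer.BirchSwinnertonDyer.Theorems.RamifiedBottomIndexVacuity

end
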